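import Literature.MathematicalPhysics.KineticTheory.CollisionTubePullbackPathwise
import Literature.MathematicalPhysics.KineticTheory.CollisionSumMarkComparison
import HarnessLib

/-!
# The collision-cylinder pull-back along hard-sphere orbits: velocity cut and collision-moment remainders

Topic `Literature/MathematicalPhysics/KineticTheory` (proof item; wanted by the crux line `Sketch` of
`InformationPercolationEngine.PercolationClosesChaos`, stmt-AtomisticToContinuum-14915, helper stub
`stub_pullbackInProb`).  Boltzmann's collision-cylinder argument read on ONE hard-sphere orbit (CIP 1994
§2.2, App. 4.A; GST 2013 §4.1) in the form needed under a law that controls only COLLISION MOMENTS: for a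
continuous weight `w(t, x)` bounded by `C_w` on `[0, τ] × 𝕋³` with a modulus of continuity `(Δ₁, ϵ₁)` there,
a bounded continuous collision mark `Ξ` (no velocity decay) and the continuous velocity cut
`cut_L(v, v') = (min(L − max(‖v‖, ‖v'‖), 1))₊` (`CollisionSumMarkComparison`),

  `|K_N[w · Ξ] − ∫₀^τ A_t[w · Ξ cut_L] dt| ≤ C_w C_Ξ K_N[f_V] + C_Ξ ϵ₁ K_N[1]`
  `+ 3 C_w C_Ξ ((N+1)κ)⁻¹ R_short[1] + C_w C_Ξ · ε/(N+1) · (2 N₃ + P(Φ_τ z))`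

(`cylinderPullback_velocityCut_pathwise`) along every good orbit, once `ε(1 + 2Lκ) < 1/2` and
`κ ε (1 + 4L) ≤ Δ₁`; here `f_V(v, v') = (min(max(‖v‖,‖v'‖) − V, 1))₊` (`V + 1 ≤ L`) is the fast-pair mark,
`K_N[1]` the normalised collision count, `R_short[1]` the unmarked short-flight deficit, `N₃` the three-body
collision sum, `P` the pair shell count — exactly the four functionals of a "window collision moments"
hypothesis.  Ingredients: the pathwise pull-back `cylinderPullback_pathwise` for the cut mark; the velocity
tail `K_N[w Ξ (1 − cut_L)]` bounded by the fast-pair collision sum; the continuity correction for the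
density-free weight (`g ≡ 1`) reduced to `κε C_Ξ ϵ₁ Σ_coll 1 + 2 C_w R_short[Ξ_L]` WITHOUT any energy or
mean-displacement input, because a collision with non-zero cut mark has post-collisional speeds `< 4L`
(`abs_weightAt_one_sub_le`, `setIntegral_abs_weightAt_one_sub_le`, `continuityCorrection_one_le`); and
`R_short[Ξ_L] ≤ C_Ξ R_short[1]`.

## References

* C. Cercignani, R. Illner, M. Pulvirenti, *The Mathematical Theory of Dilute Gases* (1994), §2.2,
  App. 4.A. [CIPDiluteGases1994]
* I. Gallagher, L. Saint-Raymond, B. Texier, *From Newton to Boltzmann* (2013), Part II Ch. 4, §4.1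
  (Prop. 4.1.1, Def. 4.1.2). [GallagherSaintRaymondTexier2013]
-/

noncomputable section

open MeasureTheory Set Filter Topology
open scoped ENNReal InnerProductSpace BigOperators

namespace Literature.MathematicalPhysics.KineticTheory

open _root_.MeasureTheory Literature.Analysis.FluidPDE

/-! ### The continuity correction for a density-free weight (`g ≡ 1`) -/

section Continuity

variable {σ : ℝ} {N : ℕ} {Φ : HardSphereFlow (Torus.geometry (Fin 3)) (hsDiameter σ N) (N + 1)}
  {z : Config (N + 1) (Fin 3) T3} {w : ℝ × UnitAddTorus (Fin 3) → ℝ} {ρ κ τ Cw Δ₁ ϵ₁ : ℝ}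

/-- **Controlled oscillation of a density-free weight.** At a collision `s > 0` of the ordered contact pair
`(i, j)` of a good orbit with `κε(1 + ‖vᵢ(s)‖ + ‖vⱼ(s)‖) ≤ Δ₁`, for a time `t` of the window
`[max(0, s − κε), s]` after the pair flight start, the weight `w(·, xᵢ(·))` read at `t` and at `s` differ
by at most `ϵ₁`, `(Δ₁, ϵ₁)` being a modulus of continuity of `w` on `[0, τ] × 𝕋³` (displacement
`≤ κε (‖vᵢ‖ + ‖vⱼ‖)` on the free stretch). [folklore] -/
theorem abs_weightAt_one_sub_le (hz : z ∈ Φ.good) (hσ : 0 < σ) (hκ : 0 < κ)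
    (hwuc : ∀ p ∈ Icc (0 : ℝ) τ ×ˢ (univ : Set (UnitAddTorus (Fin 3))),
      ∀ q ∈ Icc (0 : ℝ) τ ×ˢ (univ : Set (UnitAddTorus (Fin 3))), dist p q ≤ Δ₁ → dist (w p) (w q) ≤ ϵ₁)
    {s : ℝ} (hs : s ∈ Icc 0 τ) (hs0 : 0 < s) {i j : Fin (N + 1)}
    (hp : (i, j) ∈ contactPairs (Torus.geometry (Fin 3)) (hsDiameter σ N) (orbit σ N Φ z s))
    (hS : κ * hsDiameter σ N * (1 + (‖(orbit σ N Φ z s i).2‖ + ‖(orbit σ N Φ z s j).2‖)) ≤ Δ₁)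
    {t : ℝ} (ht : t ∈ Icc (max 0 (s - κ * hsDiameter σ N)) s) (hta : pairFlightStart σ N Φ z i j s ≤ t) :
    |weightAt σ N w (fun _ => 1) ρ t (orbit σ N Φ z t) i - weightAt σ N w (fun _ => 1) ρ s (orbit σ N Φ z s) i| ≤ ϵ₁ := by
  have hε0 : 0 < hsDiameter σ N := hsDiameter_pos hσ N
  set a := pairFlightStart σ N Φ z i j s with hadef
  set S := ‖(orbit σ N Φ z s i).2‖ + ‖(orbit σ N Φ z s j).2‖ with hSdef
  have hS0 : 0 ≤ S := by positivity
  have ha : a < s := pairFlightStart_lt hz i j hs0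
  have hfree := fun u (hu : u ∈ Ioo a s) => not_participates_of_mem_Ioo_pairFlightStart hz i j hu
  have hts : s - t ≤ κ * hsDiameter σ N := by
    have h1 := ht.1
    rw [max_le_iff] at h1
    linarith [h1.2]
  have hts0 : 0 ≤ s - t := sub_nonneg.2 ht.2
  have habs : |t - s| ≤ κ * hsDiameter σ N := by rw [abs_sub_comm, abs_of_nonneg hts0]; exact hts
  have ht0τ : t ∈ Icc (0 : ℝ) τ := ⟨(le_max_left _ _).trans ht.1, ht.2.trans hs.2⟩
  have hκε : 0 ≤ κ * hsDiameter σ N := by positivity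
  have hv : ‖(orbit σ N Φ z a i).2‖ ≤ S := norm_vel_pairFlightStart_le hz hs0 hp
  have hdi : Torus.euclidDist (orbit σ N Φ z t i).1 (orbit σ N Φ z s i).1 ≤ κ * hsDiameter σ N * S := by
    have h := euclidDist_orbit_pos_le hz i ha.le (fun u hu => (hfree u hu).1) ⟨hta, ht.2⟩ ⟨ha.le, le_rfl⟩
    exact h.trans (mul_le_mul habs hv (norm_nonneg _) hκε)
  have hd : dist (t, (orbit σ N Φ z t i).1) (s, (orbit σ N Φ z s i).1) ≤ Δ₁ := by
    rw [Prod.dist_eq, max_le_iff]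
    constructor
    · rw [Real.dist_eq]
      refine habs.trans (le_trans ?_ hS)
      nlinarith
    · calc dist (orbit σ N Φ z t i).1 (orbit σ N Φ z s i).1
          ≤ Torus.euclidDist (orbit σ N Φ z t i).1 (orbit σ N Φ z s i).1 := by
            rw [dist_eq_norm]; exact Torus.norm_sub_le_euclidDist_holds _ _
        _ ≤ κ * hsDiameter σ N * S := hdi
        _ ≤ κ * hsDiameter σ N * (1 + S) := by nlinarith
        _ ≤ Δ₁ := hS
  have h := hwuc (t, (orbit σ N Φ z t i).1) ⟨ht0τ, mem_univ _⟩ (s, (orbit σ N Φ z s i).1) ⟨hs, mem_univ _⟩ hd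
  rw [Real.dist_eq] at h
  unfold weightAt
  simpa only [mul_one] using h

/-- **The window integral of the oscillation of a density-free weight.** Under the hypotheses of
`abs_weightAt_one_sub_le` (for all times of the window after the pair flight start) and `|w| ≤ C_w` on
`[0, τ] × 𝕋³`: `∫_{[max(0,s−κε), s]} |w(t, xᵢ(t)) − w(s, xᵢ(s))| dt ≤ κε ϵ₁ + 2 C_w (a − (s − κε))₊`,
`a` the pair flight start (before `a` the oscillation is bounded crudely). [folklore] -/
theorem setIntegral_abs_weightAt_one_sub_le (hz : z ∈ Φ.good) (hσ : 0 < σ) (hρ : 0 < ρ) (hκ : 0 < κ)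
    (hϵ₁ : 0 ≤ ϵ₁) (hwb : ∀ t ∈ Icc (0 : ℝ) τ, ∀ x, |w (t, x)| ≤ Cw)
    (hwuc : ∀ p ∈ Icc (0 : ℝ) τ ×ˢ (univ : Set (UnitAddTorus (Fin 3))),
      ∀ q ∈ Icc (0 : ℝ) τ ×ˢ (univ : Set (UnitAddTorus (Fin 3))), dist p q ≤ Δ₁ → dist (w p) (w q) ≤ ϵ₁)
    {s : ℝ} (hs : s ∈ Icc 0 τ) {i j : Fin (N + 1)}
    (hp : (i, j) ∈ contactPairs (Torus.geometry (Fin 3)) (hsDiameter σ N) (orbit σ N Φ z s))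
    (hS : κ * hsDiameter σ N * (1 + (‖(orbit σ N Φ z s i).2‖ + ‖(orbit σ N Φ z s j).2‖)) ≤ Δ₁) :
    ∫ t in Icc (max 0 (s - κ * hsDiameter σ N)) s,
        |weightAt σ N w (fun _ => 1) ρ t (orbit σ N Φ z t) i - weightAt σ N w (fun _ => 1) ρ s (orbit σ N Φ z s) i| ≤
      κ * hsDiameter σ N * ϵ₁ + 2 * Cw * max (pairFlightStart σ N Φ z i j s - (s - κ * hsDiameter σ N)) 0 := by
  have hε0 : 0 < hsDiameter σ N := hsDiameter_pos hσ N
  have hκε : 0 < κ * hsDiameter σ N := mul_pos hκ hε0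
  have hCw : 0 ≤ Cw := (abs_nonneg _).trans (hwb s hs (orbit σ N Φ z s i).1)
  have hgb : ∀ a : ℝ, 0 ≤ a → |(fun _ : ℝ => (1 : ℝ)) a| ≤ 1 := fun a _ => by simp
  set a := pairFlightStart σ N Φ z i j s with hadef
  set A := max 0 (s - κ * hsDiameter σ N) with hAdef
  have hAs : A ≤ s := max_le hs.1 (by linarith)
  set f : ℝ → ℝ := fun t => |weightAt σ N w (fun _ => 1) ρ t (orbit σ N Φ z t) i -
    weightAt σ N w (fun _ => 1) ρ s (orbit σ N Φ z s) i| with hfdef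
  set h : ℝ → ℝ := fun t => ϵ₁ + (Iio a).indicator (fun _ => 2 * Cw) t with hhdef
  have hpt : ∀ t ∈ Icc A s, f t ≤ h t := by
    intro t ht
    have ht0τ : t ∈ Icc (0 : ℝ) τ := ⟨(le_max_left _ _).trans ht.1, ht.2.trans hs.2⟩
    by_cases hlt : t < a
    · rw [hhdef]
      dsimp only
      rw [indicator_of_mem (show t ∈ Iio a from hlt)]
      have h1 := abs_weightAt_le (N := N) hwb hgb hσ.le hρ ht0τ (orbit σ N Φ z t) i
      have h2 := abs_weightAt_le (N := N) hwb hgb hσ.le hρ hs (orbit σ N Φ z s) i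
      calc f t ≤ |weightAt σ N w (fun _ => 1) ρ t (orbit σ N Φ z t) i| +
            |weightAt σ N w (fun _ => 1) ρ s (orbit σ N Φ z s) i| := abs_sub _ _
        _ ≤ Cw * 1 + Cw * 1 := add_le_add h1 h2
        _ ≤ ϵ₁ + 2 * Cw := by linarith
    · rw [hhdef]
      dsimp only
      rw [indicator_of_notMem (show t ∉ Iio a from hlt), add_zero]
      rcases eq_or_lt_of_le ht.2 with rfl | hlt'
      · rw [hfdef]
        dsimp only
        rw [sub_self, abs_zero]
        exact hϵ₁
      · have hs0 : 0 < s := lt_of_le_of_lt ((le_max_left _ _).trans ht.1) hlt'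
        exact abs_weightAt_one_sub_le hz hσ hκ hwuc hs hs0 hp hS ht (not_lt.1 hlt)
  have hvolW : (volume (Icc A s)).toReal ≤ κ * hsDiameter σ N := by
    rw [Real.volume_Icc, ENNReal.toReal_ofReal (sub_nonneg.2 hAs)]
    have : s - κ * hsDiameter σ N ≤ A := le_max_right _ _
    linarith
  have hvolI : (volume (Iio a ∩ Icc A s)).toReal ≤ max (a - (s - κ * hsDiameter σ N)) 0 := by
    have h1 : volume (Iio a ∩ Icc A s) ≤ ENNReal.ofReal (a - A) := by
      rw [← Real.volume_Icc]
      exact measure_mono fun t ht => ⟨ht.2.1, le_of_lt ht.1⟩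
    calc (volume (Iio a ∩ Icc A s)).toReal ≤ (ENNReal.ofReal (a - A)).toReal :=
          ENNReal.toReal_mono ENNReal.ofReal_ne_top h1
      _ = max (a - A) 0 := ENNReal.toReal_ofReal'
      _ ≤ max (a - (s - κ * hsDiameter σ N)) 0 := max_le_max (by
          have : s - κ * hsDiameter σ N ≤ A := le_max_right _ _
          linarith) le_rfl
  have hh1 : IntegrableOn (fun _ : ℝ => ϵ₁) (Icc A s) volume := integrableOn_const (hs := measure_Icc_lt_top.ne)
  have hh2 : IntegrableOn ((Iio a).indicator fun _ : ℝ => 2 * Cw) (Icc A s) volume :=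
    IntegrableOn.indicator (integrableOn_const (hs := measure_Icc_lt_top.ne)) measurableSet_Iio
  have hint : ∫ t in Icc A s, h t = ϵ₁ * (volume (Icc A s)).toReal + 2 * Cw * (volume (Iio a ∩ Icc A s)).toReal := by
    rw [hhdef]
    show ∫ t in Icc A s, (ϵ₁ + (Iio a).indicator (fun _ : ℝ => 2 * Cw) t) = _
    rw [integral_add hh1 hh2, setIntegral_const, integral_indicator measurableSet_Iio, setIntegral_const,
      measureReal_restrict_apply measurableSet_Iio, measureReal_def, measureReal_def, smul_eq_mul, smul_eq_mul]
    ring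
  by_cases hI : IntegrableOn f (Icc A s)
  · have hh : IntegrableOn h (Icc A s) := hh1.add hh2
    have hC2 : 0 ≤ 2 * Cw := by positivity
    calc ∫ t in Icc A s, f t ≤ ∫ t in Icc A s, h t := setIntegral_mono_on hI hh measurableSet_Icc hpt
      _ = ϵ₁ * (volume (Icc A s)).toReal + 2 * Cw * (volume (Iio a ∩ Icc A s)).toReal := hint
      _ ≤ ϵ₁ * (κ * hsDiameter σ N) + 2 * Cw * max (a - (s - κ * hsDiameter σ N)) 0 :=
          add_le_add (mul_le_mul_of_nonneg_left hvolW hϵ₁) (mul_le_mul_of_nonneg_left hvolI hC2)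
      _ = κ * hsDiameter σ N * ϵ₁ + 2 * Cw * max (a - (s - κ * hsDiameter σ N)) 0 := by ring
  · rw [integral_undef hI]
    positivity

/-- **Pathwise reduction of the continuity correction for a density-free weight and a velocity-cut mark.**
If the mark `Ξ'` is supported on pairs with `‖v‖ + ‖w‖ < 2L` (as `Ξ · cut_L` is) and `κ ε (1 + 4L) ≤ Δ₁`,
then every collision with non-zero mark has post-collisional speeds summing to `< 4L`
(`norm_add_norm_le_two_mul_reflectVel`), hence a controlled oscillation, and
`R_cont[w, Ξ'] ≤ κε C_Ξ ϵ₁ · Σ_{coll} 1 + 2 C_w · R_short[Ξ']` — no energy input. [folklore] -/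
theorem continuityCorrection_one_le (hz : z ∈ Φ.good) (hσ : 0 < σ) (hρ : 0 < ρ) (hκ : 0 < κ)
    {Ξ' : V3 × V3 × V3 → ℝ} {CΞ L : ℝ} (hϵ₁ : 0 ≤ ϵ₁)
    (hwb : ∀ t ∈ Icc (0 : ℝ) τ, ∀ x, |w (t, x)| ≤ Cw) (hΞb : ∀ q, |Ξ' q| ≤ CΞ)
    (hwuc : ∀ p ∈ Icc (0 : ℝ) τ ×ˢ (univ : Set (UnitAddTorus (Fin 3))),
      ∀ q ∈ Icc (0 : ℝ) τ ×ˢ (univ : Set (UnitAddTorus (Fin 3))), dist p q ≤ Δ₁ → dist (w p) (w q) ≤ ϵ₁)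
    (hΞL : ∀ n v v' : V3, Ξ' (n, v, v') ≠ 0 → ‖v‖ + ‖v'‖ < 2 * L)
    (hΔ : κ * hsDiameter σ N * (1 + 4 * L) ≤ Δ₁) :
    continuityCorrection σ N Φ τ w (fun _ => 1) Ξ' ρ κ z ≤
      κ * hsDiameter σ N * (CΞ * ϵ₁) *
          collisionPairSum (Torus.geometry (Fin 3)) (hsDiameter σ N) (orbit σ N Φ z) (Icc 0 τ) (fun _ _ _ => (1 : ℝ)) +
        2 * Cw * shortFlightDeficit σ N Φ τ Ξ' κ z := by
  have hfin : (collisionTimes (Torus.geometry (Fin 3)) (hsDiameter σ N) (orbit σ N Φ z) ∩ Icc 0 τ).Finite :=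
    (isTraj hz).locFinite 0 τ
  have hε0 : 0 < hsDiameter σ N := hsDiameter_pos hσ N
  have hκε : 0 ≤ κ * hsDiameter σ N := (mul_pos hκ hε0).le
  have hCΞ : 0 ≤ CΞ := (abs_nonneg _).trans (hΞb (0, 0, 0))
  unfold continuityCorrection shortFlightDeficit
  rw [← collisionPairSum_const_mul hfin, ← collisionPairSum_const_mul hfin, ← collisionPairSum_add hfin]
  refine collisionPairSum_mono hfin fun s hs p hp => ?_
  have hCw : 0 ≤ Cw := (abs_nonneg _).trans (hwb s hs.2 (orbit σ N Φ z s p.1).1)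
  by_cases hm : collMark σ N Ξ' (orbit σ N Φ z s) p.1 p.2 = 0
  · rw [hm, abs_zero, zero_mul, zero_mul, mul_zero, add_zero, mul_one]
    positivity
  · -- the collision has slow post-collisional velocities
    have hpre := hΞL _ _ _ hm
    have hpost : ‖(orbit σ N Φ z s p.1).2‖ + ‖(orbit σ N Φ z s p.2).2‖ < 4 * L := by
      have h := norm_add_norm_le_two_mul_reflectVel (sepAt (orbit σ N Φ z s) p.1 p.2)
        ((orbit σ N Φ z s p.1).2, (orbit σ N Φ z s p.2).2)
      simp only at h
      linarith
    have hS : κ * hsDiameter σ N * (1 + (‖(orbit σ N Φ z s p.1).2‖ + ‖(orbit σ N Φ z s p.2).2‖)) ≤ Δ₁ :=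
      le_trans (mul_le_mul_of_nonneg_left (by linarith) hκε) hΔ
    have hI := setIntegral_abs_weightAt_one_sub_le hz hσ hρ hκ hϵ₁ hwb hwuc hs.2 (i := p.1) (j := p.2) hp hS
    have hcm : |collMark σ N Ξ' (orbit σ N Φ z s) p.1 p.2| ≤ CΞ := hΞb _
    calc |collMark σ N Ξ' (orbit σ N Φ z s) p.1 p.2| *
          ∫ t in Icc (max 0 (s - κ * hsDiameter σ N)) s,
            |weightAt σ N w (fun _ => 1) ρ t (orbit σ N Φ z t) p.1 - weightAt σ N w (fun _ => 1) ρ s (orbit σ N Φ z s) p.1|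
        ≤ |collMark σ N Ξ' (orbit σ N Φ z s) p.1 p.2| *
            (κ * hsDiameter σ N * ϵ₁ + 2 * Cw * max (pairFlightStart σ N Φ z p.1 p.2 s - (s - κ * hsDiameter σ N)) 0) :=
          mul_le_mul_of_nonneg_left hI (abs_nonneg _)
      _ = κ * hsDiameter σ N * (|collMark σ N Ξ' (orbit σ N Φ z s) p.1 p.2| * ϵ₁) +
            2 * Cw * (|collMark σ N Ξ' (orbit σ N Φ z s) p.1 p.2| *
              max (pairFlightStart σ N Φ z p.1 p.2 s - (s - κ * hsDiameter σ N)) 0) := by ring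
      _ ≤ κ * hsDiameter σ N * (CΞ * ϵ₁) * 1 +
            2 * Cw * (|collMark σ N Ξ' (orbit σ N Φ z s) p.1 p.2| *
              max (pairFlightStart σ N Φ z p.1 p.2 s - (s - κ * hsDiameter σ N)) 0) := by
          rw [mul_one]
          gcongr

end Continuity

/-! ### The pull-back with velocity cut and collision-moment remainders -/

/-- **THE PATHWISE CYLINDER PULL-BACK WITH VELOCITY CUT.**  Along the orbit of a good initial datum `z`
(`N + 1` spheres of diameter `ε = hsDiameter σ N` on `𝕋³`), for a continuous weight `w` with `|w| ≤ C_w`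
and modulus `(Δ₁, ϵ₁)` on `[0, τ] × 𝕋³`, a bounded continuous mark `|Ξ| ≤ C_Ξ`, levels `V + 1 ≤ L`,
`1 ≤ L`, and a flight-time parameter `κ > 0` with `ε(1 + 2Lκ) < 1/2`, `κε(1 + 4L) ≤ Δ₁`:
`|K_N[w Ξ] − ∫₀^τ A_t[w, Ξ cut_L] dt| ≤ C_w C_Ξ K_N[f_V] + C_Ξ ϵ₁ K_N[1] + 3 C_w C_Ξ ((N+1)κ)⁻¹ R_short[1]`
`+ C_w C_Ξ ε/(N+1) (2 N₃ + P(Φ_τ z))`. [folklore] -/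
theorem cylinderPullback_velocityCut_pathwise {σ : ℝ} {N : ℕ}
    {Φ : HardSphereFlow (Torus.geometry (Fin 3)) (hsDiameter σ N) (N + 1)} {z : Config (N + 1) (Fin 3) T3}
    {w : ℝ × UnitAddTorus (Fin 3) → ℝ} {Ξ : V3 × V3 × V3 → ℝ} {τ ρ κ L V Cw CΞ Δ₁ ϵ₁ : ℝ}
    (hz : z ∈ Φ.good) (hσ : 0 < σ) (hτ : 0 < τ) (hρ : 0 < ρ) (hκ : 0 < κ) (hL : 1 ≤ L) (hVL : V + 1 ≤ L)
    (hsmall : hsDiameter σ N * (1 + 2 * L * κ) < 1 / 2) (hΔ : κ * hsDiameter σ N * (1 + 4 * L) ≤ Δ₁)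
    (hw : Continuous w) (hwb : ∀ t ∈ Icc (0 : ℝ) τ, ∀ x, |w (t, x)| ≤ Cw)
    (hwuc : ∀ p ∈ Icc (0 : ℝ) τ ×ˢ (univ : Set (UnitAddTorus (Fin 3))),
      ∀ q ∈ Icc (0 : ℝ) τ ×ˢ (univ : Set (UnitAddTorus (Fin 3))), dist p q ≤ Δ₁ → dist (w p) (w q) ≤ ϵ₁)
    (hϵ₁ : 0 ≤ ϵ₁) (hΞ : Continuous Ξ) (hΞb : ∀ q, |Ξ q| ≤ CΞ) (ϑ : ℝ) :
    |Literature.MathematicalPhysics.KineticTheory.collisionSum σ N Φ τ w (fun _ => 1) Ξ ρ z -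
        tubeTimeStat σ N Φ τ w (fun _ => 1) (fun q => Ξ q * max (min (L - max ‖q.2.1‖ ‖q.2.2‖) 1) 0) ρ ϑ 1 κ z| ≤
      Cw * CΞ * Literature.MathematicalPhysics.KineticTheory.collisionSum σ N Φ τ (fun _ => 1) (fun _ => 1)
          (fun q => max (min (max ‖q.2.1‖ ‖q.2.2‖ - V) 1) 0) 1 z +
        CΞ * ϵ₁ * Literature.MathematicalPhysics.KineticTheory.collisionSum σ N Φ τ (fun _ => 1) (fun _ => 1)
          (fun _ => 1) 1 z +
        3 * (Cw * CΞ) * (((N + 1 : ℝ) * κ)⁻¹ * shortFlightDeficit σ N Φ τ (fun _ => 1) κ z) +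
        Cw * CΞ * (hsDiameter σ N / (N + 1 : ℝ)) *
          (2 * threeBodyCollisionSum σ N Φ τ L κ z + pairShellCount σ N L κ (Φ.flow τ z)) := by
  set ΞL : V3 × V3 × V3 → ℝ := fun q => Ξ q * max (min (L - max ‖q.2.1‖ ‖q.2.2‖) 1) 0 with hΞL
  set fV : V3 × V3 × V3 → ℝ := fun q => max (min (max ‖q.2.1‖ ‖q.2.2‖ - V) 1) 0 with hfV
  have hL0 : 0 < L := one_pos.trans_le hL
  have hN : (0 : ℝ) < N + 1 := by exact_mod_cast Nat.succ_pos N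
  have hc : 0 ≤ ((N + 1 : ℝ) * κ)⁻¹ := (inv_pos.2 (mul_pos hN hκ)).le
  have hε0 : 0 < hsDiameter σ N := hsDiameter_pos hσ N
  have hCw : 0 ≤ Cw := (abs_nonneg _).trans (hwb 0 ⟨le_rfl, hτ.le⟩ 0)
  have hCΞ : 0 ≤ CΞ := (abs_nonneg _).trans (hΞb (0, 0, 0))
  -- the cut mark
  have hΞLc : Continuous ΞL := hΞ.mul (continuous_velCut L)
  have hΞLb : ∀ q, |ΞL q| ≤ CΞ := fun q => by
    rw [hΞL]; dsimp only
    rw [abs_mul, abs_of_nonneg (velCut_mem_Icc L q).1]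
    exact (mul_le_mul (hΞb q) (velCut_mem_Icc L q).2 (velCut_mem_Icc L q).1 hCΞ).trans (mul_one _).le
  have hΞL0 : ∀ n v v' : V3, 2 * L ≤ ‖v' - v‖ → ΞL (n, v, v') = 0 := fun n v v' h => by
    rw [hΞL]; dsimp only
    rw [velCut_eq_zero_of_le (q := (n, v, v')) h, mul_zero]
  have hΞLsupp : ∀ n v v' : V3, ΞL (n, v, v') ≠ 0 → ‖v‖ + ‖v'‖ < 2 * L := by
    intro n v v' h
    rw [hΞL] at h; dsimp only at h
    have hm := max_norm_lt_of_velCut_ne_zero (q := (n, v, v')) (right_ne_zero_of_mul h)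
    simp only at hm
    have h1 : ‖v‖ ≤ max ‖v‖ ‖v'‖ := le_max_left _ _
    have h2 : ‖v'‖ ≤ max ‖v‖ ‖v'‖ := le_max_right _ _
    linarith
  have hgb : ∀ a : ℝ, 0 ≤ a → |(fun _ : ℝ => (1 : ℝ)) a| ≤ 1 := fun a _ => by simp
  -- (1) the velocity tail
  have htail : |Literature.MathematicalPhysics.KineticTheory.collisionSum σ N Φ τ w (fun _ => 1) Ξ ρ z -
      Literature.MathematicalPhysics.KineticTheory.collisionSum σ N Φ τ w (fun _ => 1) ΞL ρ z| ≤
      Cw * CΞ * Literature.MathematicalPhysics.KineticTheory.collisionSum σ N Φ τ (fun _ => 1) (fun _ => 1) fV 1 z := by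
    rw [collisionSum_sub_mark hz]
    have h := abs_collisionSum_le_of_abs_le (τ := τ) hz hσ.le (Ξ := Ξ - ΞL) (f := fV) (Cχ := Cw) (Cg := 1)
      (CΞ := CΞ) hρ hwb hgb (fun q => ?_) 1
    · simpa only [mul_one] using h
    · rw [Pi.sub_apply, hΞL]
      dsimp only
      rw [← mul_one_sub, abs_mul]
      refine mul_le_mul (hΞb q) ?_ (abs_nonneg _) hCΞ
      rw [abs_of_nonneg (sub_nonneg.2 (velCut_mem_Icc L q).2)]
      exact one_sub_velCut_le_fastMark hVL q
  -- (2) the pathwise pull-back of the cut mark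
  have hpath := cylinderPullback_pathwise σ N Φ τ w (fun _ => 1) ΞL ρ ϑ κ L Cw 1 CΞ z hz hσ hτ hρ hκ hL0.le hsmall
    hw continuous_const hΞLc hwb hgb hΞLb hΞL0
  -- (3) the continuity correction and (4) the short-flight deficit of the cut mark
  have hcont := continuityCorrection_one_le (τ := τ) hz hσ hρ hκ hϵ₁ hwb hΞLb hwuc hΞLsupp hΔ
  have hshort := shortFlightDeficit_le_of_abs_le (τ := τ) hz hΞLb κ
  have hshort0 : 0 ≤ shortFlightDeficit σ N Φ τ (fun _ => (1 : ℝ)) κ z :=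
    collisionPairSum_nonneg fun _ _ _ => mul_nonneg (abs_nonneg _) (le_max_right _ _)
  -- (5) the collision count
  have hcount := collisionSum_one_eq (τ := τ) hz (1 : ℝ)
  have hK1 : ((N + 1 : ℝ) * κ)⁻¹ * (κ * hsDiameter σ N * (CΞ * ϵ₁) *
      collisionPairSum (Torus.geometry (Fin 3)) (hsDiameter σ N) (orbit σ N Φ z) (Icc 0 τ) (fun _ _ _ => (1 : ℝ))) =
      CΞ * ϵ₁ * Literature.MathematicalPhysics.KineticTheory.collisionSum σ N Φ τ (fun _ => 1) (fun _ => 1)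
        (fun _ => 1) 1 z := by
    rw [hcount]
    field_simp
  -- assemble
  have hmid : |Literature.MathematicalPhysics.KineticTheory.collisionSum σ N Φ τ w (fun _ => 1) ΞL ρ z -
      tubeTimeStat σ N Φ τ w (fun _ => 1) ΞL ρ ϑ 1 κ z| ≤
      CΞ * ϵ₁ * Literature.MathematicalPhysics.KineticTheory.collisionSum σ N Φ τ (fun _ => 1) (fun _ => 1)
          (fun _ => 1) 1 z +
        3 * (Cw * CΞ) * (((N + 1 : ℝ) * κ)⁻¹ * shortFlightDeficit σ N Φ τ (fun _ => 1) κ z) +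
        Cw * CΞ * (hsDiameter σ N / (N + 1 : ℝ)) *
          (2 * threeBodyCollisionSum σ N Φ τ L κ z + pairShellCount σ N L κ (Φ.flow τ z)) := by
    refine hpath.trans ?_
    have h1 : ((N + 1 : ℝ) * κ)⁻¹ * (continuityCorrection σ N Φ τ w (fun _ => 1) ΞL ρ κ z +
        Cw * 1 * shortFlightDeficit σ N Φ τ ΞL κ z) ≤
        CΞ * ϵ₁ * Literature.MathematicalPhysics.KineticTheory.collisionSum σ N Φ τ (fun _ => 1) (fun _ => 1)
          (fun _ => 1) 1 z +
        3 * (Cw * CΞ) * (((N + 1 : ℝ) * κ)⁻¹ * shortFlightDeficit σ N Φ τ (fun _ => 1) κ z) := by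
      rw [← hK1]
      have h2 : continuityCorrection σ N Φ τ w (fun _ => 1) ΞL ρ κ z + Cw * 1 * shortFlightDeficit σ N Φ τ ΞL κ z ≤
          κ * hsDiameter σ N * (CΞ * ϵ₁) *
            collisionPairSum (Torus.geometry (Fin 3)) (hsDiameter σ N) (orbit σ N Φ z) (Icc 0 τ) (fun _ _ _ => (1 : ℝ)) +
          3 * Cw * (CΞ * shortFlightDeficit σ N Φ τ (fun _ => 1) κ z) := by
        have h3 : Cw * shortFlightDeficit σ N Φ τ ΞL κ z ≤ Cw * (CΞ * shortFlightDeficit σ N Φ τ (fun _ => 1) κ z) :=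
          mul_le_mul_of_nonneg_left hshort hCw
        linarith
      calc ((N + 1 : ℝ) * κ)⁻¹ * (continuityCorrection σ N Φ τ w (fun _ => 1) ΞL ρ κ z +
            Cw * 1 * shortFlightDeficit σ N Φ τ ΞL κ z)
          ≤ ((N + 1 : ℝ) * κ)⁻¹ * (κ * hsDiameter σ N * (CΞ * ϵ₁) *
            collisionPairSum (Torus.geometry (Fin 3)) (hsDiameter σ N) (orbit σ N Φ z) (Icc 0 τ) (fun _ _ _ => (1 : ℝ)) +
          3 * Cw * (CΞ * shortFlightDeficit σ N Φ τ (fun _ => 1) κ z)) := mul_le_mul_of_nonneg_left h2 hc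
        _ = _ := by ring
    have h4 : Cw * 1 * CΞ * (hsDiameter σ N / (N + 1 : ℝ)) *
        (2 * threeBodyCollisionSum σ N Φ τ L κ z + pairShellCount σ N L κ (Φ.flow τ z)) =
        Cw * CΞ * (hsDiameter σ N / (N + 1 : ℝ)) *
          (2 * threeBodyCollisionSum σ N Φ τ L κ z + pairShellCount σ N L κ (Φ.flow τ z)) := by ring
    linarith
  calc |Literature.MathematicalPhysics.KineticTheory.collisionSum σ N Φ τ w (fun _ => 1) Ξ ρ z -
        tubeTimeStat σ N Φ τ w (fun _ => 1) ΞL ρ ϑ 1 κ z|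
      ≤ |Literature.MathematicalPhysics.KineticTheory.collisionSum σ N Φ τ w (fun _ => 1) Ξ ρ z -
          Literature.MathematicalPhysics.KineticTheory.collisionSum σ N Φ τ w (fun _ => 1) ΞL ρ z| +
        |Literature.MathematicalPhysics.KineticTheory.collisionSum σ N Φ τ w (fun _ => 1) ΞL ρ z -
          tubeTimeStat σ N Φ τ w (fun _ => 1) ΞL ρ ϑ 1 κ z| := abs_sub_le _ _ _
    _ ≤ _ := by linarith [htail, hmid]

end Literature.MathematicalPhysics.KineticTheory

end
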